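import Literature.MathematicalPhysics.QuantumFieldTheory.Balaban1983to89.B4Lemma22DualL1

/-!
# B4 Lemma 2.2 (2.17) at CONSTANT configurations `A₀`: all three members (`n ≤ 1`) in both extreme rows
# `q = p = ∞` and `q = p = 1`, on boxes — the gauge reduction of p. 581 for the `ℓ¹` row, plus duality

T. Bałaban, *Regularity and decay of lattice Green's functions*, Commun. Math. Phys. **89** (1983) 571–597 (= B4).
Lemma 2.2, pp. 577–578 [PDF 7–8] (transcript `HOME/b2b-balaban-b04/transcript-B4.md` ll. 104–110), verbatim:
«and a constant c₂ depending on d, p₁, such that (2.17) ‖G_k(□,Ã)f‖_q, ‖D^η_{Ã,μ}G_k(□,Ã)f‖_q,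
‖G_k(□,Ã)D^{η*}_{Ã,μ}f‖_q ≤ c₂‖f‖_p for 1 ≤ p, q ≤ ∞, satisfying the condition 1/p − 1/p₁ ≤ 1/q ≤ 1/p with
p₁ > d.»  Proof, p. 581 [PDF 11] (ll. 166–170): «Lemma 2.2 in the case of a constant configuration A₀ is
equivalent to the case of configuration A₀ = 0 by the same argument with the gauge transformation as before.
Thus we have reduced the proof of this lemma to a proof of the» «corresponding properties for the propagator
G_k(□,0), or to the one-component propagator G_k(□) [G_k(□,0) = G_k(□)1, 1 is identity operator on R^N].»
and p. 583 [PDF 13]: «For q = p = 1 we get it by duality argument».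

## What is certified here (kernel theorems; HONEST SCOPE below)

For [B4]'s Green's function `G_k(□,A₀) = B4Lemma22ReduceZero.greenA0` at a CONSTANT configuration `A₀` on a box
(any block embedding `emb` and contour system `Γ` ending at the averaged point) and the covariant derivative
`D^η_{A₀,μ} = derivA0`, uniformly over the window `amin ≤ a ≤ aplus`, `0 ≤ m² ≤ m2plus`, the box and `A₀`:

* §1 `supN_transpose_le` — the REVERSE duality `‖M‖_{1→1} ≤ C ⇒ ‖Mᵀ‖_{∞→∞} ≤ C` for the mixed norms
  `supN`/`l1N` of `B4Lemma22Reduce231` (single-site dual witness `siteW`; companion of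
  `B4Lemma22DualL1.l1N_transpose_le`).
* §2 `const_box_l1` — the `ℓ¹` row of the constant-configuration hypotheses: `‖G_k(□,A₀)f‖₁ ≤ c‖f‖₁` and
  `‖D^η_{A₀,μ}G_k(□,A₀)f‖₁ ≤ c‖f‖₁`, from the tree's zero-field column sums (`B4Lemma22ReduceZero.zero_box_l1`)
  by the gauge step (`b4Green_constBond`, `covDeriv_constBond`, `l1_hyps_conj`) — the typed form of the two
  quoted p. 581 sentences for the row `q = p = 1` (the `q = p = ∞` row is `B4Lemma22ReduceZero.const_box_sup`).
* §3 HEADLINE `lemma22_17_const_rows` — (2.17) at constant `A₀`, ALL THREE MEMBERS `G_k(□,A₀)`,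
  `D^η_{A₀,μ}G_k(□,A₀)`, `G_k(□,A₀)D^{η*}_{A₀,μ}` in BOTH rows `q = p = ∞` and `q = p = 1` with one constant
  `c`: the third member is obtained from the second by the symmetry `G_k(□,A₀)ᵀ = G_k(□,A₀)`
  (`B4Lemma22DualL1.b4Green_transpose`), `G D^{η*}_μ = (D^η_μ G)ᵀ`, and the two dualities.  Here `D^{η*}_μ` is
  typed as the matrix transpose `(derivA0 μ)ᵀ` — the adjoint for the `η`-lattice scalar product, whose constant
  weight `η^d` is the same on both sides.

HONEST SCOPE: (a) constant configurations `A₀` only — for [B4]'s `G_k(□,Ã)`, `Ã = A₀ + A′`, the tree has the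
first two members at `q = p = ∞` (`B4Lemma22SupStair.lemma22_17_sup_stair`) and the first and third members at
`q = p = 1` (`B4Lemma22DualL1.lemma22_17_l1_stair`); the second member at `q = p = 1` (equivalently the third at
`q = p = ∞`) for `G_k(□,Ã)` needs an `ℓ¹` first-order smallness of `V_k` and is NOT proved here; (b) boxes only
(the zero-field inputs are box theorems); (c) members `n = 2` and the intermediate `(p,q)` range of (2.17) are not
instantiated; (d) constants: one unoptimised `c = max` of the tree's zero-field row/column-sum constants.  No step
of the manuscript is used as a hypothesis of a theorem claiming a printed conclusion; 0 cited facts; every theorem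
is proved from the lineage's definitions; standard axioms only.
-/

namespace Literature.MathematicalPhysics.QuantumFieldTheory.Balaban1983to89.B4Lemma22ConstRows

open Finset Matrix
open scoped Kronecker
open Literature.MathematicalPhysics.QuantumFieldTheory.Balaban1983to89.B4GaugeCovariance
open Literature.MathematicalPhysics.QuantumFieldTheory.Balaban1983to89.B4Lemma21Region (siteNorm covDeriv)
open Literature.MathematicalPhysics.QuantumFieldTheory.Balaban1983to89.B4Lemma22Reduce231
open Literature.MathematicalPhysics.QuantumFieldTheory.Balaban1983to89.B4Reflection242 (boxDom)
open Literature.MathematicalPhysics.QuantumFieldTheory.Balaban1983to89.B4BoxCov237 (boxOpR_det_isUnit)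
open Literature.MathematicalPhysics.QuantumFieldTheory.Balaban1983to89.B4Lemma22ReduceZero
open Literature.MathematicalPhysics.QuantumFieldTheory.Balaban1983to89.B4Lemma22DualL1

noncomputable section

/-! ## §1 Reverse duality `‖M‖_{1→1} ≤ C ⇒ ‖Mᵀ‖_{∞→∞} ≤ C` -/

section Dual

variable {X : Type*} [Fintype X] [DecidableEq X] {ι : Type} [Fintype ι]

/-- The single-site dual witness: `B4Lemma22DualL1.dualW Ψ` restricted to the site `x` (zero elsewhere).
[folklore] -/
def siteW (Ψ : X × ι → ℝ) (x : X) : X × ι → ℝ := fun p => if p.1 = x then dualW Ψ p else 0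

omit [Fintype X] in
/-- At the chosen site the witness is the normalised value `ψ(x)/|ψ(x)|`. [folklore] -/
theorem fld_siteW_self (Ψ : X × ι → ℝ) (x : X) : fld (siteW Ψ x) x = fld (dualW Ψ) x := by
  ext i
  simp [fld_apply, siteW]

omit [Fintype X] in
/-- Away from the chosen site the witness vanishes. [folklore] -/
theorem fld_siteW_ne (Ψ : X × ι → ℝ) {x y : X} (h : y ≠ x) : fld (siteW Ψ x) y = 0 := by
  ext i
  simp [fld_apply, siteW, h]

/-- `‖siteW Ψ x‖₁ ≤ 1`. [folklore] -/
theorem l1N_siteW_le (Ψ : X × ι → ℝ) (x : X) : l1N (siteW Ψ x) ≤ 1 := by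
  unfold l1N
  rw [Finset.sum_eq_single x (fun y _ hy => by rw [fld_siteW_ne Ψ hy, siteNorm_zero])
    (fun h => absurd (Finset.mem_univ x) h), fld_siteW_self]
  exact siteNorm_dualW_le Ψ x

omit [Fintype X] [DecidableEq X] in
/-- `⟨ψ(x)/|ψ(x)|, ψ(x)⟩ = |ψ(x)|` (per-site form of `B4Lemma22DualL1.dualW_dot`). [folklore] -/
theorem fld_dualW_dot (Ψ : X × ι → ℝ) (x : X) : fld (dualW Ψ) x ⬝ᵥ fld Ψ x = siteNorm (fld Ψ x) := by
  rw [fld_dualW, smul_dotProduct, smul_eq_mul]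
  have h0 : 0 ≤ fld Ψ x ⬝ᵥ fld Ψ x := Finset.sum_nonneg fun i _ => mul_self_nonneg _
  have hsq : fld Ψ x ⬝ᵥ fld Ψ x = siteNorm (fld Ψ x) ^ 2 := by
    unfold siteNorm
    rw [Real.sq_sqrt h0]
  rw [hsq]
  by_cases h : siteNorm (fld Ψ x) = 0
  · rw [h]; simp
  · rw [sq, ← mul_assoc, inv_mul_cancel₀ h, one_mul]

/-- `⟨siteW Ψ x, Ψ⟩ = |ψ(x)|`. [folklore] -/
theorem siteW_dot (Ψ : X × ι → ℝ) (x : X) : siteW Ψ x ⬝ᵥ Ψ = siteNorm (fld Ψ x) := by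
  rw [dotProduct_eq_sum_fld, Finset.sum_eq_single x (fun y _ hy => by rw [fld_siteW_ne Ψ hy, zero_dotProduct])
    (fun h => absurd (Finset.mem_univ x) h), fld_siteW_self, fld_dualW_dot]

/-- **REVERSE DUALITY `‖M‖_{1→1} ≤ C ⇒ ‖Mᵀ‖_{∞→∞} ≤ C`** for the mixed norms `‖·‖₁ = l1N`, `‖·‖_∞ = supN`:
`|(MᵀΦ)(x)| = ⟨Φ, M(siteW)⟩ ≤ ‖Φ‖_∞‖M siteW‖₁ ≤ C‖Φ‖_∞`.
[cite: Balaban1983RegularityDecay, p. 583 «For q = p = 1 we get it by duality argument»] -/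
theorem supN_transpose_le {M : Matrix (X × ι) (X × ι) ℝ} {C : ℝ} (hC : 0 ≤ C)
    (h : ∀ u, l1N (M *ᵥ u) ≤ C * l1N u) (Φ : X × ι → ℝ) : supN (Mᵀ *ᵥ Φ) ≤ C * supN Φ := by
  refine supN_le (mul_nonneg hC (supN_nonneg Φ)) fun x => ?_
  have h1 : siteNorm (fld (Mᵀ *ᵥ Φ) x) = Φ ⬝ᵥ (M *ᵥ siteW (Mᵀ *ᵥ Φ) x) := by
    rw [← siteW_dot (Mᵀ *ᵥ Φ) x, Matrix.dotProduct_mulVec, Matrix.vecMul_transpose, dotProduct_comm]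
  rw [h1]
  calc Φ ⬝ᵥ (M *ᵥ siteW (Mᵀ *ᵥ Φ) x) ≤ supN Φ * l1N (M *ᵥ siteW (Mᵀ *ᵥ Φ) x) :=
        dotProduct_le_supN_mul_l1N _ _
    _ ≤ supN Φ * (C * l1N (siteW (Mᵀ *ᵥ Φ) x)) := mul_le_mul_of_nonneg_left (h _) (supN_nonneg Φ)
    _ ≤ supN Φ * (C * 1) :=
        mul_le_mul_of_nonneg_left (mul_le_mul_of_nonneg_left (l1N_siteW_le _ _) hC) (supN_nonneg Φ)
    _ = C * supN Φ := by ring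

end Dual

/-! ## §2 The `ℓ¹` row of the constant-configuration hypotheses, by the gauge step of p. 581 -/

section Const

variable {ι : Type} [Fintype ι] [DecidableEq ι]

/-- **THE CONSTANT-`A₀` `ℓ¹`-NORM HYPOTHESES** («Lemma 2.2 in the case of a constant configuration A₀ is
equivalent to the case of configuration A₀ = 0 by the same argument with the gauge transformation as before» —
here PROVED for the row `q = p = 1`, members `G` and `D^η_μG`, on boxes): uniformly over the window, the box,
the contour system and `A₀`, `‖G_k(□,A₀)f‖₁ ≤ c‖f‖₁` and `‖D^η_{A₀,μ}G_k(□,A₀)f‖₁ ≤ c‖f‖₁` — from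
`B4Lemma22ReduceZero.zero_box_l1` by the gauge step (`b4Green_constBond`, `covDeriv_constBond`, `l1_hyps_conj`).
[cite: Balaban1983RegularityDecay, Lemma 2.2 (2.17) p. 578; p. 581; p. 583] -/
theorem const_box_l1 (F : OrthFlow ι) (κ : ℝ) (d ℓ : ℕ) (hℓ : 1 ≤ ℓ) (amin aplus m2plus : ℝ) (ha : 0 < amin) :
    ∃ c : ℝ, 0 < c ∧ ∀ (k : ℕ), 1 ≤ k → ∀ (a m2 : ℝ), amin ≤ a → a ≤ aplus → 0 ≤ m2 → m2 ≤ m2plus →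
      ∀ (M : Fin (d + 1) → ℕ), (∀ i, 1 ≤ M i) →
      ∀ (emb : ↥(boxDom M) → ↥(Box d ℓ k M)) (Γ : ↥(boxDom M) → ↥(Box d ℓ k M) → List ↥(Box d ℓ k M)),
        (∀ y x, blkWt ((ℓ + 1) ^ k) M (fun i => (ℓ + 1) ^ k * M i) y x ≠ 0 → pathEnd (emb y) (Γ y x) = x) →
      ∀ (A₀ : Fin (d + 1) → ℝ),
        (∀ f : ↥(Box d ℓ k M) × ι → ℝ,
            l1N (greenA0 d F κ ℓ k a m2 M emb Γ A₀ *ᵥ f) ≤ c * l1N f) ∧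
        (∀ (μ : Fin (d + 1)) (f : ↥(Box d ℓ k M) × ι → ℝ),
            l1N (derivA0 d F κ ℓ k M A₀ μ *ᵥ (greenA0 d F κ ℓ k a m2 M emb Γ A₀ *ᵥ f)) ≤ c * l1N f) := by
  obtain ⟨c, hc, h⟩ := zero_box_l1 ι d ℓ hℓ amin aplus m2plus ha
  refine ⟨c, hc, ?_⟩
  intro k hk a m2 e1 e2 e3 e4 M hM emb Γ hend A₀
  obtain ⟨h0, hD⟩ := h k hk a m2 e1 e2 e3 e4 M hM
  have hL : (1 : ℝ) < (ℓ : ℝ) + 1 := by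
    have : (1 : ℝ) ≤ (ℓ : ℝ) := by exact_mod_cast hℓ
    linarith
  have hak : 0 < B1.aSeq a ((ℓ : ℝ) + 1) k := B1.aSeq_pos (lt_of_lt_of_le ha e1) hL hk
  have hn : 1 ≤ (ℓ + 1) ^ k := Nat.one_le_pow _ _ (Nat.succ_pos ℓ)
  have hS : IsUnit (scalarOp (boxWt ((ℓ + 1) ^ k) (fun i => (ℓ + 1) ^ k * M i)) m2
      (B1.aSeq a ((ℓ : ℝ) + 1) k * (((((ℓ + 1) ^ k : ℕ)) : ℝ) ^ (d + 1))⁻¹)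
      (blkWt ((ℓ + 1) ^ k) M (fun i => (ℓ + 1) ^ k * M i))).det := by
    rw [scalarOp_box hn]
    exact boxOpR_det_isUnit hn hak e3 hM
  have hg : IsGauge (fun u : ↥(Box d ℓ k M) => F.U (κ * linGauge A₀ Subtype.val u)) := F.isGauge _
  have hG : greenA0 d F κ ℓ k a m2 M emb Γ A₀
      = blockDiag (fun u : ↥(Box d ℓ k M) => F.U (κ * linGauge A₀ Subtype.val u))
          * (gk d ℓ k a m2 M ⊗ₖ (1 : Matrix ι ι ℝ))
          * (blockDiag fun u : ↥(Box d ℓ k M) => F.U (κ * linGauge A₀ Subtype.val u))ᵀ := by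
    dsimp only [greenA0]
    rw [b4Green_constBond F κ _ m2 _ hend A₀ _ hS, scalarOp_box hn]
  have hDer : ∀ μ, derivA0 d F κ ℓ k M A₀ μ
      = blockDiag (fun u : ↥(Box d ℓ k M) => F.U (κ * linGauge A₀ Subtype.val u))
          * (dk d ℓ k M μ ⊗ₖ (1 : Matrix ι ι ℝ))
          * (blockDiag fun u : ↥(Box d ℓ k M) => F.U (κ * linGauge A₀ Subtype.val u))ᵀ := fun μ => by
    dsimp only [derivA0]
    rw [covDeriv_constBond]
  obtain ⟨c0, cD⟩ := l1_hyps_conj (κ := Fin (d + 1)) (D := fun μ => dk d ℓ k M μ ⊗ₖ (1 : Matrix ι ι ℝ))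
    hg h0 hD
  refine ⟨fun f => ?_, fun μ f => ?_⟩
  · rw [hG]
    exact c0 f
  · rw [hG, hDer μ]
    exact cD μ f

/-! ## §3 Headline: (2.17) at constant `A₀`, all three members, rows `q = p = ∞` and `q = p = 1` -/

/-- **LEMMA 2.2 (2.17) AT A CONSTANT CONFIGURATION `A₀`, ALL THREE MEMBERS `G_k(□,A₀)f`, `D^η_{A₀,μ}G_k(□,A₀)f`,
`G_k(□,A₀)D^{η*}_{A₀,μ}f`, IN BOTH EXTREME ROWS `q = p = ∞` AND `q = p = 1`**, on boxes, uniformly over the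
window, the box, the contour system and `A₀`, with one constant `c`.  The third member comes from the second by
`G_k(□,A₀)ᵀ = G_k(□,A₀)` (`b4Green_transpose`), `G D^{η*}_μ = (D^η_μ G)ᵀ`, and the dualities
`B4Lemma22DualL1.l1N_transpose_le` / `supN_transpose_le` («For q = p = 1 we get it by duality argument»).
[cite: Balaban1983RegularityDecay, Lemma 2.2 (2.17) p. 578; p. 581; p. 583] -/
theorem lemma22_17_const_rows (F : OrthFlow ι) (κ : ℝ) (d ℓ : ℕ) (hℓ : 1 ≤ ℓ) (amin aplus m2plus : ℝ)
    (ha : 0 < amin) :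
    ∃ c : ℝ, 0 < c ∧ ∀ (k : ℕ), 1 ≤ k → ∀ (a m2 : ℝ), amin ≤ a → a ≤ aplus → 0 ≤ m2 → m2 ≤ m2plus →
      ∀ (M : Fin (d + 1) → ℕ), (∀ i, 1 ≤ M i) →
      ∀ (emb : ↥(boxDom M) → ↥(Box d ℓ k M)) (Γ : ↥(boxDom M) → ↥(Box d ℓ k M) → List ↥(Box d ℓ k M)),
        (∀ y x, blkWt ((ℓ + 1) ^ k) M (fun i => (ℓ + 1) ^ k * M i) y x ≠ 0 → pathEnd (emb y) (Γ y x) = x) →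
      ∀ (A₀ : Fin (d + 1) → ℝ),
        (∀ Φ : ↥(Box d ℓ k M) × ι → ℝ,
            supN (greenA0 d F κ ℓ k a m2 M emb Γ A₀ *ᵥ Φ) ≤ c * supN Φ) ∧
        (∀ (μ : Fin (d + 1)) (Φ : ↥(Box d ℓ k M) × ι → ℝ),
            supN (derivA0 d F κ ℓ k M A₀ μ *ᵥ (greenA0 d F κ ℓ k a m2 M emb Γ A₀ *ᵥ Φ)) ≤ c * supN Φ) ∧
        (∀ (μ : Fin (d + 1)) (Φ : ↥(Box d ℓ k M) × ι → ℝ),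
            supN (greenA0 d F κ ℓ k a m2 M emb Γ A₀ *ᵥ ((derivA0 d F κ ℓ k M A₀ μ)ᵀ *ᵥ Φ)) ≤ c * supN Φ) ∧
        (∀ f : ↥(Box d ℓ k M) × ι → ℝ,
            l1N (greenA0 d F κ ℓ k a m2 M emb Γ A₀ *ᵥ f) ≤ c * l1N f) ∧
        (∀ (μ : Fin (d + 1)) (f : ↥(Box d ℓ k M) × ι → ℝ),
            l1N (derivA0 d F κ ℓ k M A₀ μ *ᵥ (greenA0 d F κ ℓ k a m2 M emb Γ A₀ *ᵥ f)) ≤ c * l1N f) ∧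
        (∀ (μ : Fin (d + 1)) (f : ↥(Box d ℓ k M) × ι → ℝ),
            l1N (greenA0 d F κ ℓ k a m2 M emb Γ A₀ *ᵥ ((derivA0 d F κ ℓ k M A₀ μ)ᵀ *ᵥ f)) ≤ c * l1N f) := by
  obtain ⟨c₁, hc₁, h₁⟩ := const_box_sup F κ d ℓ hℓ amin aplus m2plus ha
  obtain ⟨c₂, hc₂, h₂⟩ := const_box_l1 F κ d ℓ hℓ amin aplus m2plus ha
  refine ⟨max c₁ c₂, lt_max_of_lt_left hc₁, ?_⟩
  intro k hk a m2 e1 e2 e3 e4 M hM emb Γ hend A₀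
  obtain ⟨hs0, hsD⟩ := h₁ k hk a m2 e1 e2 e3 e4 M hM emb Γ hend A₀
  obtain ⟨hl0, hlD⟩ := h₂ k hk a m2 e1 e2 e3 e4 M hM emb Γ hend A₀
  set G := greenA0 d F κ ℓ k a m2 M emb Γ A₀ with hGdef
  have hGt : Gᵀ = G := b4Green_transpose F κ _ _ _ _ _ _ _
  have hthird : ∀ μ, G * (derivA0 d F κ ℓ k M A₀ μ)ᵀ = (derivA0 d F κ ℓ k M A₀ μ * G)ᵀ := fun μ => by
    rw [Matrix.transpose_mul, hGt]
  have hc1 : c₁ ≤ max c₁ c₂ := le_max_left _ _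
  have hc2 : c₂ ≤ max c₁ c₂ := le_max_right _ _
  have hC0 : 0 ≤ max c₁ c₂ := hc₁.le.trans hc1
  refine ⟨fun Φ => ?_, fun μ Φ => ?_, fun μ Φ => ?_, fun f => ?_, fun μ f => ?_, fun μ f => ?_⟩
  · exact (hs0 Φ).trans (mul_le_mul_of_nonneg_right hc1 (supN_nonneg Φ))
  · exact (hsD μ Φ).trans (mul_le_mul_of_nonneg_right hc1 (supN_nonneg Φ))
  · rw [Matrix.mulVec_mulVec, hthird μ]
    refine (supN_transpose_le hc₂.le (fun u => ?_) Φ).trans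
      (mul_le_mul_of_nonneg_right hc2 (supN_nonneg Φ))
    rw [← Matrix.mulVec_mulVec]
    exact hlD μ u
  · exact (hl0 f).trans (mul_le_mul_of_nonneg_right hc2 (l1N_nonneg f))
  · exact (hlD μ f).trans (mul_le_mul_of_nonneg_right hc2 (l1N_nonneg f))
  · rw [Matrix.mulVec_mulVec, hthird μ]
    refine (l1N_transpose_le hc₁.le (fun Φ => ?_) f).trans
      (mul_le_mul_of_nonneg_right hc1 (l1N_nonneg f))
    rw [← Matrix.mulVec_mulVec]
    exact hsD μ Φ

end Const

end

end Literature.MathematicalPhysics.QuantumFieldTheory.Balaban1983to89.B4Lemma22ConstRows
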